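import Summits.AtomisticToContinuum.Crystallization.Theorems.FreeSplittingCertificatesStrictSplittingRuleFarPencilWeighted

/-!
# `StrictSplittingRule` (stmt-AtomisticToContinuum-12560): the weighted far pencil WITHOUT compact support — integrability form

Route `FreeSplittingCertificates`, crux r3 `StrictSplittingRule` (H12⋆ = `stub_coreJointCoercive`), unit b2b-freesplit-B gen 11.
VALUE = the form of `farPencil_weighted_integral_le` (`…FarPencilWeighted`, which assumes `HasCompactSupport v`) that the far field of the
H12⋆ architecture actually needs: outside the support of the lattice displacement the co-rotated far field is AFFINE
(`v = −u_P − W(y − y_P)`, HOME FAR-LEMMA-SPEC §7 (f)(iv), CERT §18 (5)), hence NOT compactly supported; its weighted densities are still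
integrable (`|x|⁻⁵ … |x|⁻⁶` decay).  Here the weighted chain of `…FarPencilWeighted` is re-run under exactly the hypotheses it uses:

* `integral_sq_mul_fpFluxDeriv_of_integrable`: `∫ Φⱼ·∂ⱼ(χ²) = −∫ χ²·∂ⱼΦⱼ` from integrability of `χ²∂ⱼΦⱼ`, `Φⱼ∂ⱼ(χ²)`, `Φⱼχ²` alone;
* `integral_sq_mul_fpDivFlux_of_integrable`: `∫ χ²·div Φ = −∫ 2χ⟪∇χ, Φ⟫`;
* **`farPencil_weighted_integral_le_of_integrable`**: for `v ∈ C²`, `χ ∈ C²` with `0 ∉ tsupport χ` and the weighted densities integrable,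
  `∫ χ²·Num ≤ (17/200)·∫ χ²·Den + (1/18)·∫ 2χ⟪∇χ, Φ⟫`.
No condition on `v` at the reference site (every integrand carries `χ` or `χ²`, which vanish near `0`), no compact support.
HONEST FRAMING: theorem about test fields and a weight; the verification of the integrability hypotheses for the affine-tail class is a separate
file; the lattice→continuum transfer and the near certificate are untouched; NOT a proof of H12⋆, NOT summit progress.
-/

noncomputable section

open MeasureTheory Topology Filter

namespace Summit.AtomisticToContinuum.Crystallization.Theorems.StrictSplittingRuleBirth

variable {v : (Fin 3 → ℝ) → (Fin 3 → ℝ)} {χ : (Fin 3 → ℝ) → ℝ}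

/-- **`∫ Φⱼ·∂ⱼ(χ²) = −∫ χ²·∂ⱼΦⱼ`** from integrability alone (integration by parts for line derivatives, weight `g = χ²`;
the line derivative of `Φⱼ` is needed only on `tsupport χ² ∌ 0`). -/
theorem integral_sq_mul_fpFluxDeriv_of_integrable (hv : ContDiff ℝ 2 v) (hχ : ContDiff ℝ 2 χ)
    (hχ0 : (0 : Fin 3 → ℝ) ∉ tsupport χ) (j : Fin 3)
    (i1 : Integrable fun y => fpFluxDeriv v y j j * χ y ^ 2)
    (i2 : Integrable fun y => fpFlux v y j * (2 * χ y * fpGradS χ y j))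
    (i3 : Integrable fun y => fpFlux v y j * χ y ^ 2) :
    ∫ y, fpFlux v y j * (2 * χ y * fpGradS χ y j) = - ∫ y, fpFluxDeriv v y j j * χ y ^ 2 := by
  have h1 : ContDiff ℝ 1 (fderiv ℝ v) := hv.fderiv_right (by norm_num)
  have h := integral_bilinear_hasLineDerivAt_right_eq_neg_left_of_integrable
    (μ := (volume : Measure (Fin 3 → ℝ))) (B := ContinuousLinearMap.mul ℝ ℝ) (v := fpE j)
    (f := fun z => fpFlux v z j) (f' := fun y => fpFluxDeriv v y j j)
    (g := fun y => χ y ^ 2) (g' := fun y => 2 * χ y * fpGradS χ y j)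
    (by simpa using i1) (by simpa using i2) (by simpa using i3)
    (fun y hy => by
      have hy0 : y ≠ 0 := by
        rintro rfl
        exact hχ0 ((tsupport_mul_subset_left (f := χ) (g := χ)) (by simpa [sq] using hy))
      exact hasLineDerivAt_fpFlux hy0 (hv.differentiable (by simp) y) (h1.differentiable (by simp) y) j j)
    (fun y _ => hasLineDerivAt_sq hχ y j)
  simpa using h

/-- Pointwise: `χ²·fpDivFlux = Σⱼ χ²·∂ⱼΦⱼ` (trace identity at `y ≠ 0` for a `C²` field; both sides vanish where `χ = 0`, in particular at `0`). -/
theorem sq_mul_fpDivFlux_eq (hv : ContDiff ℝ 2 v) (hχ0 : (0 : Fin 3 → ℝ) ∉ tsupport χ) (y : Fin 3 → ℝ) :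
    χ y ^ 2 * fpDivFlux y (v y) (fpGrad v y) =
      fpFluxDeriv v y 0 0 * χ y ^ 2 + fpFluxDeriv v y 1 1 * χ y ^ 2 + fpFluxDeriv v y 2 2 * χ y ^ 2 := by
  by_cases hy : y = 0
  · subst hy
    simp [image_eq_zero_of_notMem_tsupport hχ0]
  · rw [← sum_fpFluxDeriv_eq_fpDivFlux_of_contDiffAt v hy hv.contDiffAt]; ring

/-- `χ²·fpDivFlux` is integrable when the three `χ²·∂ⱼΦⱼ` are. -/
theorem integrable_sq_mul_fpDivFlux_of_integrable (hv : ContDiff ℝ 2 v) (hχ0 : (0 : Fin 3 → ℝ) ∉ tsupport χ)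
    (i1 : ∀ j : Fin 3, Integrable fun y => fpFluxDeriv v y j j * χ y ^ 2) :
    Integrable fun y => χ y ^ 2 * fpDivFlux y (v y) (fpGrad v y) := by
  have h : (fun y => χ y ^ 2 * fpDivFlux y (v y) (fpGrad v y)) =
      fun y => fpFluxDeriv v y 0 0 * χ y ^ 2 + fpFluxDeriv v y 1 1 * χ y ^ 2 + fpFluxDeriv v y 2 2 * χ y ^ 2 :=
    funext (sq_mul_fpDivFlux_eq hv hχ0)
  rw [h]
  exact ((i1 0).add (i1 1)).add (i1 2)

/-- **`∫ χ²·div Φ = −∫ 2χ·⟪∇χ, Φ⟫`** from integrability alone. -/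
theorem integral_sq_mul_fpDivFlux_of_integrable (hv : ContDiff ℝ 2 v) (hχ : ContDiff ℝ 2 χ)
    (hχ0 : (0 : Fin 3 → ℝ) ∉ tsupport χ)
    (i1 : ∀ j : Fin 3, Integrable fun y => fpFluxDeriv v y j j * χ y ^ 2)
    (i2 : ∀ j : Fin 3, Integrable fun y => fpFlux v y j * (2 * χ y * fpGradS χ y j))
    (i3 : ∀ j : Fin 3, Integrable fun y => fpFlux v y j * χ y ^ 2) :
    ∫ y, χ y ^ 2 * fpDivFlux y (v y) (fpGrad v y) = - ∫ y, 2 * χ y * fpFluxDotGrad v χ y := by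
  have hpt' : ∀ y, 2 * χ y * fpFluxDotGrad v χ y =
      fpFlux v y 0 * (2 * χ y * fpGradS χ y 0) + fpFlux v y 1 * (2 * χ y * fpGradS χ y 1) +
        fpFlux v y 2 * (2 * χ y * fpGradS χ y 2) := by
    intro y; unfold fpFluxDotGrad; ring
  simp_rw [sq_mul_fpDivFlux_eq hv hχ0, hpt']
  have e1 : ∫ y, (fpFluxDeriv v y 0 0 * χ y ^ 2 + fpFluxDeriv v y 1 1 * χ y ^ 2 + fpFluxDeriv v y 2 2 * χ y ^ 2) =
      (∫ y, (fpFluxDeriv v y 0 0 * χ y ^ 2 + fpFluxDeriv v y 1 1 * χ y ^ 2)) + ∫ y, fpFluxDeriv v y 2 2 * χ y ^ 2 :=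
    integral_add ((i1 0).add (i1 1)) (i1 2)
  have e2 : ∫ y, (fpFluxDeriv v y 0 0 * χ y ^ 2 + fpFluxDeriv v y 1 1 * χ y ^ 2) =
      (∫ y, fpFluxDeriv v y 0 0 * χ y ^ 2) + ∫ y, fpFluxDeriv v y 1 1 * χ y ^ 2 := integral_add (i1 0) (i1 1)
  have e3 : ∫ y, (fpFlux v y 0 * (2 * χ y * fpGradS χ y 0) + fpFlux v y 1 * (2 * χ y * fpGradS χ y 1) +
      fpFlux v y 2 * (2 * χ y * fpGradS χ y 2)) =
      (∫ y, (fpFlux v y 0 * (2 * χ y * fpGradS χ y 0) + fpFlux v y 1 * (2 * χ y * fpGradS χ y 1))) +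
        ∫ y, fpFlux v y 2 * (2 * χ y * fpGradS χ y 2) := integral_add ((i2 0).add (i2 1)) (i2 2)
  have e4 : ∫ y, (fpFlux v y 0 * (2 * χ y * fpGradS χ y 0) + fpFlux v y 1 * (2 * χ y * fpGradS χ y 1)) =
      (∫ y, fpFlux v y 0 * (2 * χ y * fpGradS χ y 0)) + ∫ y, fpFlux v y 1 * (2 * χ y * fpGradS χ y 1) :=
    integral_add (i2 0) (i2 1)
  rw [e1, e2, e3, e4, integral_sq_mul_fpFluxDeriv_of_integrable hv hχ hχ0 0 (i1 0) (i2 0) (i3 0),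
    integral_sq_mul_fpFluxDeriv_of_integrable hv hχ hχ0 1 (i1 1) (i2 1) (i3 1),
    integral_sq_mul_fpFluxDeriv_of_integrable hv hχ hχ0 2 (i1 2) (i2 2) (i3 2)]
  ring

/-- **THE WEIGHTED CONTINUUM FAR PENCIL, INTEGRABILITY FORM.**  For every `C²` vector field `v : ℝ³ → ℝ³` (no support condition, no condition at
the reference site) and every `C²` weight `χ` with `0 ∉ tsupport χ`, if the weighted densities `χ²·Num`, `χ²·Den`, `χ²·∂ⱼΦⱼ`, `Φⱼ·∂ⱼ(χ²)`, `Φⱼ·χ²`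
are integrable, then
`∫ χ²·Num(x, v, ∇v) ≤ (17/200)·∫ χ²·Den(x, ∇v) + (1/18)·∫ 2χ⟪∇χ, Φ⟫`.
Covers the affine-tailed far field of the architecture once its decay is checked.  NOT a proof of H12⋆, NOT summit progress. -/
theorem farPencil_weighted_integral_le_of_integrable (hv : ContDiff ℝ 2 v) (hχ : ContDiff ℝ 2 χ)
    (hχ0 : (0 : Fin 3 → ℝ) ∉ tsupport χ)
    (iN : Integrable fun y => χ y ^ 2 * fpNum y (v y) (fpGrad v y))
    (iD : Integrable fun y => χ y ^ 2 * fpDen y (fpGrad v y))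
    (i1 : ∀ j : Fin 3, Integrable fun y => fpFluxDeriv v y j j * χ y ^ 2)
    (i2 : ∀ j : Fin 3, Integrable fun y => fpFlux v y j * (2 * χ y * fpGradS χ y j))
    (i3 : ∀ j : Fin 3, Integrable fun y => fpFlux v y j * χ y ^ 2) :
    ∫ x, χ x ^ 2 * fpNum x (v x) (fpGrad v x) ≤
      17 / 200 * (∫ x, χ x ^ 2 * fpDen x (fpGrad v x)) + 1 / 18 * ∫ x, 2 * χ x * fpFluxDotGrad v χ x := by
  have iΦ := integrable_sq_mul_fpDivFlux_of_integrable hv hχ0 i1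
  have hpt : ∀ x, χ x ^ 2 * fpNum x (v x) (fpGrad v x) + 1 / 18 * (χ x ^ 2 * fpDivFlux x (v x) (fpGrad v x)) ≤
      17 / 200 * (χ x ^ 2 * fpDen x (fpGrad v x)) := by
    intro x
    have h := mul_le_mul_of_nonneg_left (farPencil_pointwise_le' x (v x) (fpGrad v x)) (sq_nonneg (χ x))
    nlinarith [h]
  have h1 : (∫ x, χ x ^ 2 * fpNum x (v x) (fpGrad v x)) + 1 / 18 * ∫ x, χ x ^ 2 * fpDivFlux x (v x) (fpGrad v x) ≤
      17 / 200 * ∫ x, χ x ^ 2 * fpDen x (fpGrad v x) := by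
    rw [← integral_const_mul, ← integral_add iN (iΦ.const_mul _), ← integral_const_mul]
    exact integral_mono (iN.add (iΦ.const_mul _)) (iD.const_mul _) hpt
  rw [integral_sq_mul_fpDivFlux_of_integrable hv hχ hχ0 i1 i2 i3] at h1
  linarith

/-- The compactly supported theorem `farPencil_weighted_integral_le` is the special case in which the five integrability hypotheses are
discharged by `HasCompactSupport v` (consistency check of the interface; the two statements agree verbatim). -/
example (hv : ContDiff ℝ 2 v) (hc : HasCompactSupport v) (hχ : ContDiff ℝ 2 χ) (hχ0 : (0 : Fin 3 → ℝ) ∉ tsupport χ) :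
    ∫ x, χ x ^ 2 * fpNum x (v x) (fpGrad v x) ≤
      17 / 200 * (∫ x, χ x ^ 2 * fpDen x (fpGrad v x)) + 1 / 18 * ∫ x, 2 * χ x * fpFluxDotGrad v χ x :=
  farPencil_weighted_integral_le_of_integrable hv hχ hχ0 (integrable_sq_mul_fpNum hv hc hχ hχ0)
    (integrable_cut_receipts hv hc hχ hχ0) (integrable_sq_mul_fpFluxDeriv hv hc hχ hχ0)
    (integrable_fpFlux_mul_grad_sq hv hc hχ hχ0) (integrable_fpFlux_mul_sq hv hc hχ hχ0)

end Summit.AtomisticToContinuum.Crystallization.Theorems.StrictSplittingRuleBirth
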